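import Summits.QuantumFields.YangMills.Theorems.BalabanUVNodesK1EndExactRowsStrict

/-!
# K1⁹ `StabilityBRunRowsAtRecordR13SepCoPHV` (stmt-QuantumFields-27364, crux r3 DECIDING) — INSIDE A TWO-SIDED (1.22) BOX, WITH ROWS (i) AND (C) HOLDING, THE END DOES NOT PAY
# ROW (iv): the FADING-KICK family (`β k v = −min 1 (max 0 ((v 0)⁻³ − k))`) lies in the box `[−1, 0]`, is box-continuous, has row (i) at every level, (W), (T) and
# `EndpointExistence (modelOf β)` — while the partial-sum floor (row (iv)) and no-(1+β₀)⁻¹-shrink FAIL at every level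

Cell `pub-ymgap`, WIDTH SEAT `pub-ymgap-dag-n13-w4` (gen 7).  `--kind proof --supports stmt-QuantumFields-27364 --as helper` (count-neutral; dag-lead KEY MAP v2).  The separating
family ym-nodeO-ideate P3 g54 LOCATED and did NOT type (evidence n°95 `memos/lines/Rev29VEndExact-P3g54.lean` :1093: «a separating family inside a two-sided box `[−b′, 0]` needs
infinitely many active steps (≈ `1∕g_0³` kicks of size `−b′`, smoothed in `g_0`) — LOCATED, NOT typed here»), typed by this seat at `b′ := 1` with the ramp smoothing
`min 1 (max 0 (g_0⁻³ − k))`.  Companion of `…K1EndExactRowsStrict` (the FIRST-KICK witness, outside any two-sided box).  [I] = [Balaban1987RG1]; [III] = [Balaban1988Convergent].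

WHY.  K1⁹'s rows conjunct asks (i) a run-wise constant remainder `|β_k − b_k| ≤ r` (⟸ any two-sided (1.22) box, sign-free: p602861), (iv) a run-wise partial-sum floor `−M` along ALL in-window
runs (the AF-sign ∕ (D1)-drift content — «the wall», CRIT-1; idea-7 g12 evidence row 3 on 27364: any proof of K1⁹ owes the (D1) sign datum on the mass-band road), (C) survivor continuity;
K2⁹ reads them only to produce the END.  File 12 (`…K1EndCriterionCeilingFree`): END ⟺ {(W), (T)} given (C) + non-crossing.  THIS FILE: one history-dependent family INSIDE the box
`[−1, 0]` — so rows (i) (`b ≡ −1∕2`, `r = 1∕2`) and every two-sided (1.22)-type bound hold at EVERY level — box-continuous (so (C) at every level), with (W), (T) at every level and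
`EndpointExistence (modelOf β)`, for which row (iv) FAILS at every level for every constant and no-(1+β₀)⁻¹-shrink FAILS at every level for every slack.  So even GIVEN rows (i) and (C)
inside a two-sided box, the END does not force row (iv): as letters, the (D1)∕AF-sign wall is a price of the PRESSED row (iv), not of the END (P3's END-exact reserve dial «WRTR» reads
{(W), (T), (C)}).  Mechanism: the run from `g_0` receives `⌊g_0⁻³⌋` unit kicks `β = −1` (then a fractional one, then none): along a top run of level `γ` the total kick is `≤ γ⁻³ + 1`
(⟹ (T) by file 13's `topRunThreshold_iff_topRunPSFloor`), but from `g_0 = ε` the `⌊ε⁻³⌋` kicks shrink the coupling by `√(1 + ε⁻¹ − ε²) → ∞` and push the partial sums below every floor.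
HONEST SCOPE: `β ≤ 0` — the kicks point the non-asymptotically-free way and die out; the family is a LETTER-LEVEL witness on a general `HBeta`, nothing about `Node00.betaOfRecord₁₃` is
claimed, and no (1.22)-type estimate of Bałaban is asserted or contradicted.

HONEST FRAMING: [folklore] real analysis on the (0.20)-recursion over the tree's carriers; every β-side letter is a HYPOTHESIS SHAPE; nothing of Bałaban asserted; NO stub of the registered
K1 v8 skeleton closed; K1⁹ ∕ K3⁸ ∕ K0⁷ OPEN; N13 NOT discharged; counts unmoved (typed 28∕28 · discharged 5∕27 · A 5∕28); [I] Thm 2 p.259 (first sentence) and (C) §1 pp.263–264 UNPROVED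
in print; one finite 𝕋⁴ programme at fixed `ε = L^{-K}`; R4 closes ONLY the CONDITIONAL finite-𝕋⁴ rung `BalabanLadder.UV` — NOT continuum ∕ ℝ⁴ ∕ OS ∕ mass gap; the Yang–Mills mass gap
(Clay) is NOT proved by any of this.  No `def`, no `instance`, no `notation`, no `axiom`.
-/

noncomputable section

namespace Summit.QuantumFields.YangMills.Theorems.BalabanUVNodesK1EndExactRowsStrictInBox

open Literature.MathematicalPhysics.QuantumFieldTheory.Balaban1983to89
open Literature.MathematicalPhysics.QuantumFieldTheory.Balaban1983to89.FlowStep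
open Literature.MathematicalPhysics.QuantumFieldTheory.Balaban1983to89.FlowStepRuns
open Literature.MathematicalPhysics.QuantumFieldTheory.Balaban1983to89.DagBinding
open Summit.QuantumFields.YangMills.Theorems.BalabanUVNodesK2NamedJetsRunRemAt (Survivors SurvCont RunConstRemainder)
open Summit.QuantumFields.YangMills.Theorems.K1NodeOLadderRunwiseEdges (exists_noShrink_of_psFloor)
open Summit.QuantumFields.YangMills.Theorems.BalabanUVNodesK1EndCriterionCeilingFree (endpointExistence_of_windowRuns_topRuns_betaContH windowRuns_of_betaUpperH)
open Summit.QuantumFields.YangMills.Theorems.BalabanUVNodesK1EndExactRowsStrict (topRunThreshold_iff_topRunPSFloor)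

/-! ## §1 The unit ramp `min 1 (max 0 t)`: its sums along `j ↦ A − j` are `≤ A + 1` (the two pointwise facts `0 ≤ · ≤ 1`, `· = 1` on `[1,∞[` are inlined where used) -/

section Ramp

/-- pointwise telescoping majorant: `min 1 (max 0 (A − j)) ≤ max 0 (A + 1 − j) − max 0 (A − j)`. [folklore] -/
theorem ramp_le_telescope (A x : ℝ) : min 1 (max 0 (A - x)) ≤ max 0 (A + 1 - x) - max 0 (A - x) := by
  rcases le_or_gt 0 (A - x) with h | h
  · rw [max_eq_right h, max_eq_right (by linarith)]
    exact (min_le_left _ _).trans (by linarith)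
  · rw [max_eq_left h.le, min_eq_right (le_refl (0:ℝ) |>.trans zero_le_one), sub_zero]
    exact le_max_left _ _

/-- **the total of the ramps `min 1 (max 0 (A − j))` over any window of integers is `≤ A + 1`** (`0 ≤ A`; telescoping of `ramp_le_telescope`). [folklore] -/
theorem sum_ramp_le (A : ℝ) (hA : 0 ≤ A) (k n : ℕ) : ∑ j ∈ Finset.Ico k n, min 1 (max 0 (A - j)) ≤ A + 1 := by
  rcases le_or_gt n k with hnk | hkn
  · rw [Finset.Ico_eq_empty_of_le hnk, Finset.sum_empty]; linarith
  set h : ℕ → ℝ := fun j => max 0 (A + 1 - j) with hh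
  have hpt : ∀ j ∈ Finset.Ico k n, min 1 (max 0 (A - (j : ℕ))) ≤ h j - h (j + 1) := by
    intro j _
    have e : h (j + 1) = max 0 (A - j) := by
      simp only [hh, Nat.cast_add, Nat.cast_one]; ring_nf
    rw [e]
    exact ramp_le_telescope A j
  refine (Finset.sum_le_sum hpt).trans ?_
  rw [Finset.sum_Ico_eq_sum_range]
  have e2 : ∀ i ∈ Finset.range (n - k), h (k + i) - h (k + i + 1) = (fun i => h (k + i)) i - (fun i => h (k + i)) (i + 1) := by
    intro i _; simp only [add_assoc]
  rw [Finset.sum_congr rfl e2, Finset.sum_range_sub']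
  have h0 : h (k + 0) ≤ A + 1 := by
    simp only [hh, add_zero]
    exact max_le (by linarith) (by linarith [(Nat.cast_nonneg k : (0:ℝ) ≤ k)])
  have hn : 0 ≤ h (k + (n - k)) := le_max_left _ _
  linarith

end Ramp

/-! ## §2 The fading-kick shape: box `[−1, 0]`, box continuity, (C), row (i), (W) -/

section FadingKick

variable {β : HBeta}

/-- **THE FADING-KICK SHAPE** is read through its defining equation `hβ : β k v = −min 1 (max 0 ((v 0)⁻³ − k))`: the run from bare coupling `g_0` receives unit kicks `β = −1` at the steps
`k ≤ g_0⁻³ − 1`, a fractional kick at the next step, and none later.  First consequence: the shape lies in the TWO-SIDED BOX `[−1, 0]` at every prefix. [folklore] -/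
theorem fadingKick_mem_box (hβ : ∀ (k : ℕ) (v : Fin (k + 1) → ℝ), β k v = -min 1 (max 0 (1 / (v 0) ^ 3 - k))) (k : ℕ) (v : Fin (k + 1) → ℝ) :
    -1 ≤ β k v ∧ β k v ≤ 0 := by
  rw [hβ]
  have h1 : 0 ≤ min 1 (max 0 (1 / (v 0) ^ 3 - (k : ℝ))) := le_min zero_le_one (le_max_left _ _)
  have h2 : min 1 (max 0 (1 / (v 0) ^ 3 - (k : ℝ))) ≤ 1 := min_le_left _ _
  constructor <;> linarith

/-- the two-sided (1.22)-type box at every level: `BetaLowerH (−1) γ β` and `BetaUpperH 0 γ β`. [cite: Balaban1987RG1, §1 (1.22) p.264 (the letter shape only)] -/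
theorem fadingKick_boxBounds (hβ : ∀ (k : ℕ) (v : Fin (k + 1) → ℝ), β k v = -min 1 (max 0 (1 / (v 0) ^ 3 - k))) (γ : ℝ) :
    BetaLowerH (-1) γ β ∧ BetaUpperH 0 γ β :=
  ⟨fun k v _ => (fadingKick_mem_box hβ k v).1, fun k v _ => (fadingKick_mem_box hβ k v).2⟩

/-- the fading-kick shape is box-continuous at every level ([I] §1 pp.263–264's letter): `v ↦ (v 0)⁻³ − k` is continuous on the box (`v 0 > 0`), the unit ramp is continuous. [folklore] -/
theorem fadingKick_cont (hβ : ∀ (k : ℕ) (v : Fin (k + 1) → ℝ), β k v = -min 1 (max 0 (1 / (v 0) ^ 3 - k))) (γ : ℝ) : BetaContH γ β := by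
  intro k
  have hf : ContinuousOn (fun v : Fin (k + 1) → ℝ => 1 / (v 0) ^ 3 - (k : ℝ)) (Box γ k) :=
    (continuousOn_const.div ((continuous_apply 0).pow 3).continuousOn fun v hv => (pow_pos ((mem_box.mp hv) 0).1 3).ne').sub
      continuousOn_const
  have hg : Continuous (fun t : ℝ => -min 1 (max 0 t)) := (continuous_const.min (continuous_const.max continuous_id)).neg
  exact (hg.comp_continuousOn hf).congr fun v _ => hβ k v

/-- hence run-wise (C) `SurvCont` at every level `γ₀ > 0`. [folklore] -/
theorem fadingKick_survCont (hβ : ∀ (k : ℕ) (v : Fin (k + 1) → ℝ), β k v = -min 1 (max 0 (1 / (v 0) ^ 3 - k))) {γ₀ : ℝ} (hγ₀ : 0 < γ₀) :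
    SurvCont β γ₀ :=
  SurvCont.of_betaContH hγ₀ (fadingKick_cont hβ γ₀)

/-- **ROW (i) AT EVERY LEVEL** for the fading-kick shape: `RunConstRemainder β (k ↦ −1∕2) (1∕2) γ` — any two-sided box gives the run-wise constant remainder (sign-free; the located reading
«row (i) as typed ⟸ the sign-free |β| box», p602861). [cite: Balaban1987RG1, Thm 3 p.264, (1.22) p.264, (5.10) p.293 (the letter shape only)] -/
theorem fadingKick_runConstRemainder (hβ : ∀ (k : ℕ) (v : Fin (k + 1) → ℝ), β k v = -min 1 (max 0 (1 / (v 0) ^ 3 - k))) (γ : ℝ) :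
    RunConstRemainder β (fun _ => -(1 / 2)) (1 / 2) γ := by
  intro n gs _ _ k _
  obtain ⟨h1, h2⟩ := fadingKick_mem_box hβ k (prefixOf gs k)
  rw [abs_le]
  constructor <;> linarith

/-- (W) for the fading-kick shape: runs of every length in every window (ceiling `0`: file 12's `windowRuns_of_betaUpperH`). [folklore] -/
theorem fadingKick_windowRuns (hβ : ∀ (k : ℕ) (v : Fin (k + 1) → ℝ), β k v = -min 1 (max 0 (1 / (v 0) ^ 3 - k))) (γ₀ : ℝ) :
    ∀ γ : ℝ, 0 < γ → γ ≤ γ₀ → ∀ K : ℕ, ∃ gs : ℕ → ℝ, RGEqH K β gs ∧ Step.InInterval γ K gs :=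
  windowRuns_of_betaUpperH (fadingKick_boxBounds hβ γ₀).2

/-! ## §3 (T) at every level and the END of the model construction -/

/-- under a non-positive β every in-window (0.20)-solution is NON-INCREASING: `g_j ≤ g_0` for `j ≤ n`. [cite: Balaban1987RG1, (0.20) p.256 (elementary)] -/
theorem run_le_start_of_nonpos (hle : ∀ (k : ℕ) (v : Fin (k + 1) → ℝ), β k v ≤ 0) {n : ℕ} {gs : ℕ → ℝ} (hrg : RGEqH n β gs)
    (hI : Step.InInterval (gs 0) n gs ∨ ∀ j, j ≤ n → 0 < gs j) : ∀ j, j ≤ n → gs j ≤ gs 0 := by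
  have hpos : ∀ j, j ≤ n → 0 < gs j := by
    rcases hI with hI | hI
    · exact fun j hj => (hI j hj).1
    · exact hI
  intro j hj
  induction j with
  | zero => exact le_rfl
  | succ j ih =>
    have hj' : j < n := Nat.lt_of_succ_le hj
    have hstep : 1 / (gs j) ^ 2 = 1 / (gs (j + 1)) ^ 2 + β j (prefixOf gs j) := hrg j hj'
    have h1 : 1 / (gs j) ^ 2 ≤ 1 / (gs (j + 1)) ^ 2 := by linarith [hle j (prefixOf gs j)]
    have hgj : 0 < gs j := hpos j hj'.le
    have hgj1 : 0 < gs (j + 1) := hpos (j + 1) hj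
    have h2 : gs (j + 1) ≤ gs j := by
      have := (one_div_le_one_div (by positivity) (by positivity)).1 h1
      exact (pow_le_pow_iff_left₀ hgj1.le hgj.le two_ne_zero).1 this
    exact h2.trans (ih hj'.le)

/-- **(T) AT EVERY LEVEL for the fading-kick shape** — through file 13's `topRunThreshold_iff_topRunPSFloor` with the level-dependent constant `M(γ) := γ⁻³ + 1`: an in-]0,γ] run sitting at
`γ` at some step has `g_0 = γ` (non-increasing couplings), so its partial sums from that step are `≥ −Σ_j min 1 (max 0 (γ⁻³ − j)) ≥ −(γ⁻³ + 1)` (`sum_ramp_le`). [folklore] -/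
theorem fadingKick_topRuns (hβ : ∀ (k : ℕ) (v : Fin (k + 1) → ℝ), β k v = -min 1 (max 0 (1 / (v 0) ^ 3 - k))) {γ : ℝ} (hγ : 0 < γ) :
    ∃ gstar : ℝ, 0 < gstar ∧ ∀ (n : ℕ) (gs : ℕ → ℝ), RGEqH n β gs → Step.InInterval γ n gs → ∀ k, k ≤ n → gs k = γ → gstar ≤ gs n := by
  refine (topRunThreshold_iff_topRunPSFloor β hγ).2 ⟨1 / γ ^ 3 + 1, by positivity, fun n gs hrg hI k hk hgk => ?_⟩
  -- the run sits at `γ` at step `k`, hence starts at `γ`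
  have hmono := run_le_start_of_nonpos (fun k v => (fadingKick_mem_box hβ k v).2) hrg (Or.inr fun j hj => (hI j hj).1)
  have hg0 : gs 0 = γ := le_antisymm (hI 0 (Nat.zero_le n)).2 (hgk ▸ hmono k hk)
  -- the partial sum is minus a sum of ramps evaluated at `A := γ⁻³`
  have hsum : ∑ j ∈ Finset.Ico k n, β j (prefixOf gs j) = -∑ j ∈ Finset.Ico k n, min 1 (max 0 (1 / γ ^ 3 - j)) := by
    rw [← Finset.sum_neg_distrib]
    refine Finset.sum_congr rfl fun j _ => ?_
    rw [hβ j (prefixOf gs j), prefixOf_apply]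
    simp [hg0]
  rw [hsum, neg_le_neg_iff]
  exact sum_ramp_le (1 / γ ^ 3) (by positivity) k n

/-- ★ **THE FADING-KICK SHAPE'S MODEL CONSTRUCTION HAS THE END**: `EndpointExistence (modelOf β)` — (W), (T) at every level and box continuity through file 12's ceiling-free ∕ floor-free
sufficiency road at the canonical construction. [cite: Balaban1987RG1, Thm 2 p.259 (first sentence), (0.17)–(0.20) pp.255–256 (elementary; nothing of the theorem asserted)] -/
theorem endpointExistence_modelOf_fadingKick (hβ : ∀ (k : ℕ) (v : Fin (k + 1) → ℝ), β k v = -min 1 (max 0 (1 / (v 0) ^ 3 - k))) :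
    EndpointExistence (modelOf β) :=
  endpointExistence_of_windowRuns_topRuns_betaContH (modelOf_forwardGenerated β) (γ₀ := 1) (γ' := 1) one_pos le_rfl (fadingKick_cont hβ 1)
    (fadingKick_windowRuns hβ 1) (fun _ hγ _ => fadingKick_topRuns hβ hγ)

/-! ## §4 Row (iv) and no-shrink FAIL at every level -/

/-- **THE EXPLICIT LONG RUN FROM `ε`**: `g_j := (ε⁻² + j)^{-1∕2}` solves (0.20) for the fading-kick shape up to `n := ⌊ε⁻³⌋` (every one of those steps is a full unit kick, `j + 1 ≤ ε⁻³`),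
stays in `]0, ε]`, starts at `g_0 = ε`, and has `g_j⁻² = ε⁻² + j`. [cite: Balaban1987RG1, (0.20) p.256 (elementary)] -/
theorem fadingKick_longRun (hβ : ∀ (k : ℕ) (v : Fin (k + 1) → ℝ), β k v = -min 1 (max 0 (1 / (v 0) ^ 3 - k))) {ε : ℝ} (hε : 0 < ε) :
    ∃ gs : ℕ → ℝ, gs 0 = ε ∧ (∀ j : ℕ, 0 < gs j ∧ gs j ≤ ε ∧ 1 / (gs j) ^ 2 = 1 / ε ^ 2 + j) ∧
      RGEqH ⌊1 / ε ^ 3⌋₊ β gs ∧ Step.InInterval ε ⌊1 / ε ^ 3⌋₊ gs := by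
  set gs : ℕ → ℝ := fun j => 1 / Real.sqrt (1 / ε ^ 2 + j) with hgs
  have hA : ∀ j : ℕ, 0 < 1 / ε ^ 2 + (j : ℝ) := fun j => by positivity
  have hsq : ∀ j : ℕ, 1 / (gs j) ^ 2 = 1 / ε ^ 2 + j := fun j => by
    simp only [hgs, div_pow, one_pow, Real.sq_sqrt (hA j).le, one_div_one_div]
  have hpos : ∀ j : ℕ, 0 < gs j := fun j => by simp only [hgs]; exact div_pos one_pos (Real.sqrt_pos.mpr (hA j))
  have h0 : gs 0 = ε := by
    simp only [hgs, Nat.cast_zero, add_zero]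
    rw [show (1 : ℝ) / ε ^ 2 = (1 / ε) ^ 2 by rw [one_div_pow], Real.sqrt_sq (by positivity), one_div_one_div]
  have hle : ∀ j : ℕ, gs j ≤ ε := fun j => by
    have h1 : 1 / ε ^ 2 ≤ 1 / (gs j) ^ 2 := by rw [hsq j]; linarith [(Nat.cast_nonneg j : (0:ℝ) ≤ j)]
    have h2 : (gs j) ^ 2 ≤ ε ^ 2 := (one_div_le_one_div (by positivity) (pow_pos (hpos j) 2)).1 h1
    exact (pow_le_pow_iff_left₀ (hpos j).le hε.le two_ne_zero).1 h2
  refine ⟨gs, h0, fun j => ⟨hpos j, hle j, hsq j⟩, fun j hj => ?_, fun j _ => ⟨hpos j, hle j⟩⟩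
  -- step `j < ⌊ε⁻³⌋`: a full unit kick
  have hj1 : (j : ℝ) + 1 ≤ 1 / ε ^ 3 := by
    have h1 : ((j + 1 : ℕ) : ℝ) ≤ (⌊1 / ε ^ 3⌋₊ : ℝ) := by exact_mod_cast hj
    have h2 : (⌊1 / ε ^ 3⌋₊ : ℝ) ≤ 1 / ε ^ 3 := Nat.floor_le (by positivity)
    push_cast at h1; linarith
  have hp0 : prefixOf gs j 0 = ε := by simp [prefixOf_apply, h0]
  have hkick : β j (prefixOf gs j) = -1 := by
    rw [hβ, hp0, min_eq_left (le_max_of_le_right (by linarith : (1 : ℝ) ≤ 1 / ε ^ 3 - (j : ℝ)))]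
  rw [hsq j, hsq (j + 1), hkick]
  push_cast; ring

/-- **NO-(1+β₀)⁻¹-SHRINK FAILS AT EVERY LEVEL FOR EVERY SLACK** for the fading-kick shape: from `g_0 = ε := min γ (1∕(2(1+β₀)²))` the long run ends at `g_n` with
`g_n⁻² = ε⁻² + ⌊ε⁻³⌋ > ε⁻² + ε⁻³ − 1`, while `ε ≤ (1+β₀)·g_n` would give `g_n⁻² ≤ (1+β₀)²ε⁻² ≤ ε⁻³∕2`.  (Shape `RunwiseMulFloor` unfolded = the last member of [III] (2.6) along runs.)
[cite: Balaban1988Convergent, (2.6) p.255 (the letter only; elementary)] -/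
theorem fadingKick_not_noShrink (hβ : ∀ (k : ℕ) (v : Fin (k + 1) → ℝ), β k v = -min 1 (max 0 (1 / (v 0) ^ 3 - k))) {γ β₀ : ℝ} (hγ : 0 < γ) (hβ₀ : 0 ≤ β₀) :
    ¬ ∀ (n : ℕ) (gs : ℕ → ℝ), RGEqH n β gs → Step.InInterval γ n gs → ∀ m n', m < n' → n' ≤ n → gs m ≤ (1 + β₀) * gs n' := by
  intro hns
  have hc : (1 : ℝ) ≤ (1 + β₀) ^ 2 := by nlinarith
  set ε : ℝ := min γ (1 / (2 * (1 + β₀) ^ 2)) with hε_def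
  have hε : 0 < ε := lt_min hγ (by positivity)
  have hεγ : ε ≤ γ := min_le_left _ _
  have hεc : ε ≤ 1 / (2 * (1 + β₀) ^ 2) := min_le_right _ _
  have hε1 : ε ≤ 1 := hεc.trans (by rw [div_le_one (by positivity)]; linarith)
  obtain ⟨gs, h0, hrun, hrg, hI⟩ := fadingKick_longRun hβ hε
  set n : ℕ := ⌊1 / ε ^ 3⌋₊ with hn_def
  have hn3 : (1 : ℝ) ≤ 1 / ε ^ 3 := by
    rw [le_div_iff₀ (by positivity), one_mul]
    calc ε ^ 3 = ε * ε * ε := by ring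
      _ ≤ 1 * 1 * 1 := by gcongr
      _ = 1 := by ring
  have hnpos : 0 < n := Nat.floor_pos.mpr hn3
  have hnlt : 1 / ε ^ 3 < (n : ℝ) + 1 := Nat.lt_floor_add_one _
  -- the no-shrink letter on this run, between steps `0` and `n`
  have hle : gs 0 ≤ (1 + β₀) * gs n := hns n gs hrg (fun i hi => ⟨(hrun i).1, (hrun i).2.1.trans hεγ⟩) 0 n hnpos le_rfl
  rw [h0] at hle
  obtain ⟨hgn, -, hsqn⟩ := hrun n
  -- `ε² ≤ (1+β₀)² g_n²`, i.e. `g_n⁻² ≤ (1+β₀)² ε⁻²`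
  have h1 : ε ^ 2 ≤ ((1 + β₀) * gs n) ^ 2 := pow_le_pow_left₀ hε.le hle 2
  have h2 : 1 / (gs n) ^ 2 ≤ (1 + β₀) ^ 2 / ε ^ 2 := by
    rw [div_le_div_iff₀ (by positivity) (by positivity), one_mul]
    calc ε ^ 2 ≤ ((1 + β₀) * gs n) ^ 2 := h1
      _ = (1 + β₀) ^ 2 * (gs n) ^ 2 := by ring
  rw [hsqn] at h2
  -- so `ε⁻² + ε⁻³ − 1 < (1+β₀)² ε⁻²`; multiply by `ε³`
  have h3 : 1 / ε ^ 2 + 1 / ε ^ 3 - 1 < (1 + β₀) ^ 2 / ε ^ 2 := by linarith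
  have h4 : ε + 1 - ε ^ 3 < (1 + β₀) ^ 2 * ε := by
    have hε3 : 0 < ε ^ 3 := by positivity
    have := mul_lt_mul_of_pos_right h3 hε3
    have e1 : (1 / ε ^ 2 + 1 / ε ^ 3 - 1) * ε ^ 3 = ε + 1 - ε ^ 3 := by field_simp
    have e2 : (1 + β₀) ^ 2 / ε ^ 2 * ε ^ 3 = (1 + β₀) ^ 2 * ε := by field_simp
    rwa [e1, e2] at this
  have h5 : (1 + β₀) ^ 2 * ε ≤ 1 / 2 :=
    calc (1 + β₀) ^ 2 * ε ≤ (1 + β₀) ^ 2 * (1 / (2 * (1 + β₀) ^ 2)) := mul_le_mul_of_nonneg_left hεc (by positivity)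
      _ = 1 / 2 := by field_simp
  have h6 : ε ^ 3 ≤ ε := by
    calc ε ^ 3 = ε * (ε * ε) := by ring
      _ ≤ ε * (1 * 1) := by gcongr
      _ = ε := by ring
  linarith

/-- **ROW (iv) — THE RUN-WISE PARTIAL-SUM FLOOR — FAILS AT EVERY LEVEL FOR EVERY CONSTANT** for the fading-kick shape: contrapositive of dag-n24-w1's edge «(PS) floor ⟹ no-shrink on a
shrunk level» (`K1NodeOLadderRunwiseEdges.exists_noShrink_of_psFloor`, slack `1`) and `fadingKick_not_noShrink`. [cite: Balaban1987RG1, (0.20) p.256; Balaban1988Convergent, (2.6) p.255 (elementary)] -/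
theorem fadingKick_not_psFloor (hβ : ∀ (k : ℕ) (v : Fin (k + 1) → ℝ), β k v = -min 1 (max 0 (1 / (v 0) ^ 3 - k))) {γ : ℝ} (hγ : 0 < γ) (M : ℝ) :
    ¬ ∀ (n : ℕ) (gs : ℕ → ℝ), RGEqH n β gs → Step.InInterval γ n gs → ∀ k, k ≤ n → -M ≤ ∑ j ∈ Finset.Ico k n, β j (prefixOf gs j) := by
  intro hps
  obtain ⟨γ', hγ', -, hmul⟩ := exists_noShrink_of_psFloor (β := β) one_pos hγ hps
  exact fadingKick_not_noShrink hβ hγ' zero_le_one hmul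

end FadingKick

/-! ## §5 The separation INSIDE the two-sided box, with rows (i) and (C) holding -/

/-- ★★ **INSIDE A TWO-SIDED (1.22) BOX, WITH ROWS (i) AND (C) HOLDING, THE END DOES NOT PAY ROW (iv) — KERNEL WITNESS.**  One history-dependent family `β` (the fading-kick shape,
instantiated once): in the box `[−1, 0]` at every level (so EVERY two-sided (1.22)-type bound), box-continuous at every level (so run-wise (C) `SurvCont` at every level), with ROW (i)
`RunConstRemainder β (k ↦ −1∕2) (1∕2) γ` at EVERY level, (W) runs of every length in every window, (T) a top-run threshold at every level, and `EndpointExistence (modelOf β)` — for which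
ROW (iv), the run-wise partial-sum floor, FAILS at EVERY level for EVERY constant and NO-(1+β₀)⁻¹-SHRINK FAILS at EVERY level for EVERY slack `β₀ ≥ 0`.  So the END-exact letters
{(W), (T), (C)} plus row (i) plus a two-sided box do NOT imply the pressed row (iv) (nor file 10's no-shrink rung): the (D1)∕AF-sign content of (iv) is NOT a price of the END.  Sharpens
`…K1EndExactRowsStrict.endExactLetters_strictly_below_pressedRows` (first-kick, outside any box); the family P3 g54 n°95 located and did not type.  HONEST SCOPE: a letter-level witness on
a general `HBeta` with `β ≤ 0` (kicks in the non-AF direction, dying out); NOTHING about the route's `betaOfRecord₁₃ θ` is claimed. [folklore] -/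
theorem end_and_rowI_in_box_without_rowIV : ∃ β : HBeta,
    (∀ γ : ℝ, BetaLowerH (-1) γ β ∧ BetaUpperH 0 γ β) ∧ (∀ γ : ℝ, BetaContH γ β) ∧ (∀ γ₀ : ℝ, 0 < γ₀ → SurvCont β γ₀) ∧
    (∀ γ : ℝ, RunConstRemainder β (fun _ => -(1 / 2)) (1 / 2) γ) ∧
    (∀ γ : ℝ, 0 < γ → ∀ K : ℕ, ∃ gs : ℕ → ℝ, RGEqH K β gs ∧ Step.InInterval γ K gs) ∧
    (∀ γ : ℝ, 0 < γ → ∃ gstar : ℝ, 0 < gstar ∧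
      ∀ (n : ℕ) (gs : ℕ → ℝ), RGEqH n β gs → Step.InInterval γ n gs → ∀ k, k ≤ n → gs k = γ → gstar ≤ gs n) ∧
    EndpointExistence (modelOf β) ∧
    (∀ γ M : ℝ, 0 < γ →
      ¬ ∀ (n : ℕ) (gs : ℕ → ℝ), RGEqH n β gs → Step.InInterval γ n gs → ∀ k, k ≤ n → -M ≤ ∑ j ∈ Finset.Ico k n, β j (prefixOf gs j)) ∧
    (∀ γ β₀ : ℝ, 0 < γ → 0 ≤ β₀ →
      ¬ ∀ (n : ℕ) (gs : ℕ → ℝ), RGEqH n β gs → Step.InInterval γ n gs → ∀ m n', m < n' → n' ≤ n → gs m ≤ (1 + β₀) * gs n') := by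
  have hβ : ∀ (k : ℕ) (v : Fin (k + 1) → ℝ),
      (fun k w => -min 1 (max 0 (1 / (w 0) ^ 3 - k)) : HBeta) k v = -min 1 (max 0 (1 / (v 0) ^ 3 - k)) := fun _ _ => rfl
  exact ⟨fun k w => -min 1 (max 0 (1 / (w 0) ^ 3 - k)), fadingKick_boxBounds hβ, fadingKick_cont hβ, fun _ hγ₀ => fadingKick_survCont hβ hγ₀,
    fadingKick_runConstRemainder hβ, fun γ hγ => fadingKick_windowRuns hβ γ γ hγ le_rfl, fun _ hγ => fadingKick_topRuns hβ hγ,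
    endpointExistence_modelOf_fadingKick hβ, fun _ M hγ => fadingKick_not_psFloor hβ hγ M, fun _ _ hγ hβ₀ => fadingKick_not_noShrink hβ hγ hβ₀⟩

/-- **COROLLARY — K2⁹'s CONVERSE FAILS EVEN GIVEN ROW (i), (C) AND A TWO-SIDED BOX**: there is a forward-generated halting currying construction WITH `EndpointExistence`, whose β lies in a
two-sided box, is box-continuous ((C) at every level) and satisfies row (i) at every level, but has row (iv) at NO level.  (The companion `exists_endpointExistence_without_rows` of file 13
drops row (i) as well, at the price of leaving every box.) [folklore] -/
theorem exists_endpointExistence_rowI_cont_without_rowIV : ∃ β : HBeta,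
    EndpointExistence (modelOf β) ∧ (∀ γ : ℝ, BetaLowerH (-1) γ β ∧ BetaUpperH 0 γ β) ∧ (∀ γ : ℝ, BetaContH γ β) ∧
    (∀ γ : ℝ, RunConstRemainder β (fun _ => -(1 / 2)) (1 / 2) γ) ∧
    (∀ γ M : ℝ, 0 < γ →
      ¬ ∀ (n : ℕ) (gs : ℕ → ℝ), RGEqH n β gs → Step.InInterval γ n gs → ∀ k, k ≤ n → -M ≤ ∑ j ∈ Finset.Ico k n, β j (prefixOf gs j)) := by
  obtain ⟨β, hbox, hcont, -, hrem, -, -, hE, hps, -⟩ := end_and_rowI_in_box_without_rowIV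
  exact ⟨β, hE, hbox, hcont, hrem, hps⟩

end Summit.QuantumFields.YangMills.Theorems.BalabanUVNodesK1EndExactRowsStrictInBox

end
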